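import Summits.CriticalPhenomena.PercolationContinuityZ3.Theses.PercExchangeRateTransport
import Summits.CriticalPhenomena.PercolationContinuityZ3.Theorems.ModelFacts.Negative.DerivPosGuard
import Summits.CriticalPhenomena.PercolationContinuityZ3.Theorems.PercExchangeRateTransportModelFactsStubPushforward
import Literature.Probability.Percolation.ProdBernoulliRusso
import Literature.Probability.Percolation.PercolationProofs
import Literature.Probability.Percolation.SharpnessDCTProofs

/-!
# Disproof of `ModelFacts` (crux stmt-CriticalPhenomena-16064, route `PercExchangeRateTransport`)
# — findings: NO KILL; the crux is a theorem (line `pushforward`: 5/5 stubs landed, glue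
# kernel-checked); the parameter guards of clause (8) are tight on three edges and at `n = 0`

Standing disprover's work file (cdisprove, cycle 1, 2026-08-17).  Prose only in docstrings.
No `sorry`.

## Index of findings

* **Why it resists.** `ModelFacts` is a conjunction of ten unconditional bookkeeping facts about
  the label-coupled anisotropic family on `ℤ²×ℤ`; there is no hypothesis to void and no witness to
  game.  The lead's line `pushforward` reduces it to five stubs, ALL LANDED (p165705 pushforward,
  p165963 contDiff, p166253 pivotalPos, p166100 contAbove, p165641 planar) and composed by the
  sorry-free `ModelFacts_of` of the registered skeleton — so `¬ ModelFacts` is unprovable and this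
  file records tightness instead (section "Line `pushforward`" below).
* **(a) Load-bearing guards of clause (8)** (`0 < ∂_pΘ_n` for `1 ≤ n`, `(p,t) ∈ (0,1)²`):
  - `1 ≤ n`: tight — `Θ_0 ≡ 1` (LANDED p145365, `Negative/DerivPosGuard.lean`,
    `modelFacts_derivPos_false_without_guard`);
  - `p < 1`: tight — `modelFacts_derivPos_false_at_p_one` (this file; `Θ_n(1,t) = 1` is the
    maximum, Fermat ⇒ `∂_pΘ_n(1,t) = 0`);
  - `0 < p`: tight — `modelFacts_derivPos_false_at_p_zero` (plateau `Θ_n(q,t) = Θ_n(0,t)` for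
    `q ≤ 0` + monotonicity ⇒ local minimum ⇒ `deriv = 0`; at the corner `deriv` is junk `0`);
  - `t < 1`: tight — `modelFacts_derivPos_false_at_t_one` (`Θ_n(p,t) = 1` for `t ≥ 1`: the
    vertical ray alone reaches `∂Λ_n`, so `∂_pΘ_n ≡ 0` there);
  - `0 < t`: NOT load-bearing — PROVED: `clause8_holds_at_t_zero` (`0 < ∂_pΘ_n(p,0)` for
    `n ≥ 1`, `0 < p < 1`, from the landed `stub_pushforward` + tree Russo + the landed
    cylinder geometry of `stub_pivotalPos`, with positivity needed on the `x`-ray only).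
  LANDED in the tree (importable): `Theorems/ModelFacts/Negative/ClosedSquareEdges.lean` (p168753,
  edges `p = 1`, `p = 0`, `t = 1`) and `Theorems/ModelFacts/Negative/TZeroEdge.lean` (p168835,
  the `t = 0` edge: `clause8_holds_at_t_zero`, `modelFacts_derivPos_holds_at_t_zero`), both in
  namespace `…Theorems.ModelFacts.Negative`, def- and notation-free twins of the sections below.
* **(b) Tightness / boundary values.** `theta_eq_one_of_one_le_p`, `theta_eq_one_of_one_le_t`,
  `theta_eq_theta_zero_of_nonpos`, `deriv_theta_p_at_one`, `deriv_theta_p_at_zero`,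
  `deriv_theta_p_of_one_le_t` (all proved below); `Θ_1 ≤ Θ_0 = 1` (landed).
* **(c) Natural strengthenings.** Clause (8) on any closed edge except `t = 0`: REFUTED (a).
  Clause (2) globalised to `ContDiff ℝ 1` on all of `ℝ²`: false (corner of `Θ_n(·,t)` at `p = 0`,
  right slope = pivotal intensity of horizontal bonds at `p = 0⁺`, which is `> 0` for `n ≥ 1`,
  `0 < t < 1`) — remark only, a Lean proof needs the one-sided Russo formula at the boundary field.
  Clause (1) (continuity on all `ℝ²`) and clause (7) (`θ = ⨅ Θ_n` for all real `p,t`) hold by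
  clamping (`projIcc`), consistent with the plateaux proved here.
* **(d) Targets.** none (`stuck_stubs = []`); all stubs landed.
* **Attacks that found nothing** (recorded for the next seat): vacuity (no hypotheses), `n = 0`
  (guarded), parameters outside `[0,1]` (clamped: plateaux, consistent with clauses 1,3–7),
  quantifier order vs informal text (matches), junk `deriv` at the square's boundary (guarded by
  the open square — and the guard is needed, see (a)), `⨅` over `ℕ` of a bounded antitone sequence
  (well-defined, = limit), `unitInterval` coercions in clauses (9)–(10) (exactly the landed stubs).
-/

noncomputable section

open MeasureTheory Filter Topology
open Literature.Probability.Percolation Literature.Probability.LatticeModels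
open Literature.Probability.Percolation.DCT16

namespace Summit.CriticalPhenomena.PercolationContinuityZ3.Cruxes.ModelFacts.Disproof

set_option quotPrecheck false in
/-- The vertical-bond predicate of the crux (syntactic abbreviation, expands literally). -/
local notation "Vert(" e ")" =>
  (∃ x : Site 3, e = s(x, x + Pi.single (2 : Fin 3) 1))

set_option quotPrecheck false in
/-- The anisotropic configuration `cfg p t U` of the crux (syntactic abbreviation). -/
local notation "Cfg(" p ", " t ", " U ")" =>
  {e | e ∈ (zdGraph 3).edgeSet ∧ ((Vert(e) ∧ U e ≤ t) ∨ (¬ Vert(e) ∧ U e ≤ p))}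

set_option quotPrecheck false in
/-- The box one-arm probability `Θ_n(p,t)` of the crux (syntactic abbreviation). -/
local notation "Θ[" n ", " p ", " t "]" =>
  (labelMeasure (Site 3)).real {U : Sym2 (Site 3) → ℝ | Cfg(p, t, U) ∈ siteToBoundary 3 n}

/-! ## Straight coordinate rays in `Λ_n ⊂ ℤ³` -/

/-- `k eᵢ ∈ Λ_n` for `k ≤ n`. [folklore] -/
theorem axis_mem_box (i : Fin 3) {n k : ℕ} (hk : k ≤ n) :
    (Pi.single i (k : ℤ) : Site 3) ∈ box 3 n := by
  rw [mem_box]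
  intro j
  by_cases hj : j = i
  · subst hj
    simp only [Pi.single_eq_same]
    omega
  · simp only [Pi.single_apply, if_neg hj]
    omega

/-- `k eᵢ ∼ (k+1) eᵢ` in `ℤ³`. [folklore] -/
theorem axis_adj_succ (i : Fin 3) (k : ℕ) :
    (zdGraph 3).Adj (Pi.single i (k : ℤ) : Site 3) (Pi.single i ((k + 1 : ℕ) : ℤ)) :=
  (zdGraph_adj_iff _ _).2
    ⟨i, Or.inl (by push_cast; exact Pi.single_add (f := fun _ : Fin 3 => ℤ) i (k : ℤ) 1)⟩

/-- `n eᵢ ∈ ∂Λ_n`. [folklore] -/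
theorem axis_mem_innerBoundary (i : Fin 3) (n : ℕ) :
    (Pi.single i (n : ℤ) : Site 3) ∈ innerBoundary (zdGraph 3) (box 3 n) :=
  mem_innerBoundary_box_of_natAbs_eq (axis_mem_box i le_rfl) (i := i) (by simp)

/-- **If the first `n` bonds of the `i`-th coordinate ray are open then `0 ⟷ ∂Λ_n in Λ_n`.**
[folklore] -/
theorem mem_siteToBoundary_of_axis_open (i : Fin 3) {n : ℕ} {ω : Set (Sym2 (Site 3))}
    (h : ∀ k : ℕ, k < n →
      s((Pi.single i (k : ℤ) : Site 3), Pi.single i ((k + 1 : ℕ) : ℤ)) ∈ ω) :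
    ω ∈ siteToBoundary 3 n := by
  rw [mem_siteToBoundary_iff]
  refine ⟨Pi.single i (n : ℤ), axis_mem_innerBoundary i n, ?_⟩
  suffices hp : ∀ k, k ≤ n → PathIn (openGraph ω) ↑(box 3 n) 0 (Pi.single i (k : ℤ)) from
    hp n le_rfl
  intro k
  induction k with
  | zero =>
    intro _
    simp only [Nat.cast_zero, Pi.single_zero]
    exact PathIn.refl (zero_mem_box 3 n)
  | succ k ih =>
    intro hk
    refine (ih (Nat.le_of_succ_le hk)).tail ?_ (axis_mem_box i hk)
    rw [openGraph_adj]
    exact ⟨h k (Nat.lt_of_succ_le hk), (axis_adj_succ i k).ne⟩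

/-- The bonds of the vertical ray are vertical bonds of the crux. [folklore] -/
theorem vert_axis_two (k : ℕ) :
    ∃ x : Site 3, s((Pi.single (2 : Fin 3) (k : ℤ) : Site 3), Pi.single (2 : Fin 3) ((k + 1 : ℕ) : ℤ))
      = s(x, x + Pi.single (2 : Fin 3) 1) :=
  ⟨Pi.single 2 (k : ℤ), by push_cast; rw [← Pi.single_add]⟩

/-- The bonds of the `x`-ray are not vertical. [folklore] -/
theorem not_vert_axis_zero (k : ℕ) :
    ¬ ∃ x : Site 3, s((Pi.single (0 : Fin 3) (k : ℤ) : Site 3), Pi.single (0 : Fin 3) ((k + 1 : ℕ) : ℤ))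
      = s(x, x + Pi.single (2 : Fin 3) 1) := by
  rintro ⟨x, hx⟩
  rw [Sym2.eq_iff] at hx
  rcases hx with ⟨h1, h2⟩ | ⟨h1, h2⟩
  · subst h1
    have h := congr_fun h2 2
    simp at h
  · subst h2
    have h := congr_fun h1 2
    simp at h

/-! ## Null label events -/

/-- A single label lies in a Lebesgue-null subset of `[0,1]` with probability `0`. [folklore] -/
theorem labelMeasure_eval_null (e : Sym2 (Site 3)) {T : Set ℝ} (hT : MeasurableSet T)
    (h0 : (volume : Measure ℝ) (T ∩ Set.Icc 0 1) = 0) :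
    labelMeasure (Site 3) {U | U e ∈ T} = 0 := by
  have : IsProbabilityMeasure ((volume : Measure ℝ).restrict (Set.Icc (0 : ℝ) 1)) :=
    isProbabilityMeasure_volume_restrict_unitInterval
  have h1 : {U : Sym2 (Site 3) → ℝ | U e ∈ T} = (fun U : Sym2 (Site 3) → ℝ => U e) ⁻¹' T := rfl
  rw [h1, ← Measure.map_apply (measurable_pi_apply e) hT,
    show labelMeasure (Site 3) = Measure.infinitePi (fun _ : Sym2 (Site 3) =>
      (volume : Measure ℝ).restrict (Set.Icc (0 : ℝ) 1)) from rfl,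
    Measure.infinitePi_map_eval, Measure.restrict_apply hT, h0]

/-- Almost surely a given label is `≤ 1`. [folklore] -/
theorem labelMeasure_one_lt_null (e : Sym2 (Site 3)) :
    labelMeasure (Site 3) {U | 1 < U e} = 0 := by
  refine labelMeasure_eval_null e measurableSet_Ioi (measure_mono_null ?_ (measure_singleton 1))
  rintro u ⟨hu, -, hu1⟩
  exact ((not_le.2 hu) hu1).elim

/-- Almost surely a given label is `> 0`. [folklore] -/
theorem labelMeasure_nonpos_null (e : Sym2 (Site 3)) :
    labelMeasure (Site 3) {U | U e ≤ 0} = 0 := by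
  refine labelMeasure_eval_null e measurableSet_Iic (measure_mono_null ?_ (measure_singleton 0))
  rintro u ⟨hu, hu0, -⟩
  exact le_antisymm hu hu0

/-- Almost surely ALL labels are `≤ 1` (countably many bonds). [folklore] -/
theorem ae_label_le_one : ∀ᵐ U ∂(labelMeasure (Site 3)), ∀ e : Sym2 (Site 3), U e ≤ 1 := by
  rw [ae_all_iff]
  intro e
  rw [ae_iff]
  simpa only [not_le] using labelMeasure_one_lt_null e

/-- Almost surely ALL labels are `> 0`. [folklore] -/
theorem ae_label_pos : ∀ᵐ U ∂(labelMeasure (Site 3)), ∀ e : Sym2 (Site 3), 0 < U e := by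
  rw [ae_all_iff]
  intro e
  rw [ae_iff]
  simpa only [not_lt] using labelMeasure_nonpos_null e

/-! ## The three closed edges of the parameter square -/

/-- `0 ≤ Θ_n ≤ 1`. [folklore] -/
theorem theta_le_one (n : ℕ) (p t : ℝ) : Θ[n, p, t] ≤ 1 := by
  have := isProbabilityMeasure_labelMeasure (Site 3)
  exact measureReal_le_one

/-- `Θ_n` is nondecreasing in `p` (clause (3), set-level coupling). [folklore] -/
theorem theta_mono_p (n : ℕ) (t : ℝ) : Monotone fun p : ℝ => Θ[n, p, t] := by
  have := isProbabilityMeasure_labelMeasure (Site 3)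
  intro p p' hpp'
  refine measureReal_mono fun U hU => ?_
  refine isUpperSet_siteToBoundary 3 n ?_ hU
  rintro e ⟨he, h | h⟩
  · exact ⟨he, Or.inl h⟩
  · exact ⟨he, Or.inr ⟨h.1, h.2.trans hpp'⟩⟩

/-- **Edge `p ≥ 1`: `Θ_n(p,t) = 1`.** Almost surely every label is `≤ 1 ≤ p`, so the straight
`x`-ray is open and reaches `n e_x ∈ ∂Λ_n`. [folklore] -/
theorem theta_eq_one_of_one_le_p {p : ℝ} (hp : 1 ≤ p) (n : ℕ) (t : ℝ) : Θ[n, p, t] = 1 := by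
  have := isProbabilityMeasure_labelMeasure (Site 3)
  have hae : ∀ᵐ U ∂(labelMeasure (Site 3)), Cfg(p, t, U) ∈ siteToBoundary 3 n := by
    filter_upwards [ae_label_le_one] with U hU
    exact mem_siteToBoundary_of_axis_open 0 fun k _ =>
      ⟨(SimpleGraph.mem_edgeSet _).2 (axis_adj_succ 0 k),
        Or.inr ⟨not_vert_axis_zero k, (hU _).trans hp⟩⟩
  rw [measureReal_congr (ae_eq_univ.2 (mem_ae_iff.1 hae)), probReal_univ]

/-- **Edge `t ≥ 1`: `Θ_n(p,t) = 1`.** Almost surely every label is `≤ 1 ≤ t`, so the vertical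
ray is open and reaches `n e_z ∈ ∂Λ_n`. [folklore] -/
theorem theta_eq_one_of_one_le_t {t : ℝ} (ht : 1 ≤ t) (n : ℕ) (p : ℝ) : Θ[n, p, t] = 1 := by
  have := isProbabilityMeasure_labelMeasure (Site 3)
  have hae : ∀ᵐ U ∂(labelMeasure (Site 3)), Cfg(p, t, U) ∈ siteToBoundary 3 n := by
    filter_upwards [ae_label_le_one] with U hU
    exact mem_siteToBoundary_of_axis_open 2 fun k _ =>
      ⟨(SimpleGraph.mem_edgeSet _).2 (axis_adj_succ 2 k),
        Or.inl ⟨vert_axis_two k, (hU _).trans ht⟩⟩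
  rw [measureReal_congr (ae_eq_univ.2 (mem_ae_iff.1 hae)), probReal_univ]

/-- **Edge `p ≤ 0`: `Θ_n(q,t) = Θ_n(0,t)` for `q ≤ 0`.** Almost surely every label is `> 0`, so
at any level `q ≤ 0` no horizontal bond is open and the configuration does not depend on `q`.
[folklore] -/
theorem theta_eq_theta_zero_of_nonpos {q : ℝ} (hq : q ≤ 0) (n : ℕ) (t : ℝ) :
    Θ[n, q, t] = Θ[n, 0, t] := by
  refine measureReal_congr ?_
  filter_upwards [ae_label_pos] with U hU
  have hc : Cfg(q, t, U) = Cfg(0, t, U) := by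
    ext e
    simp only [Set.mem_setOf_eq]
    constructor
    · rintro ⟨he, h | h⟩
      · exact ⟨he, Or.inl h⟩
      · exact ⟨he, Or.inr ⟨h.1, h.2.trans hq⟩⟩
    · rintro ⟨he, h | h⟩
      · exact ⟨he, Or.inl h⟩
      · exact ((not_le.2 (hU e)) h.2).elim
  show (Cfg(q, t, U) ∈ siteToBoundary 3 n) = (Cfg(0, t, U) ∈ siteToBoundary 3 n)
  rw [hc]

/-- **`∂_pΘ_n(1,t) = 0`**: `Θ_n(·,t)` attains its maximum `1` at `p = 1` (Fermat). At `p = 1`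
no horizontal bond is pivotal. [folklore] -/
theorem deriv_theta_p_at_one (n : ℕ) (t : ℝ) : deriv (fun q : ℝ => Θ[n, q, t]) 1 = 0 := by
  refine IsLocalMax.deriv_eq_zero (Filter.Eventually.of_forall fun q => ?_)
  show Θ[n, q, t] ≤ Θ[n, 1, t]
  rw [theta_eq_one_of_one_le_p le_rfl n t]
  exact theta_le_one n q t

/-- **`∂_pΘ_n(p,t) = 0` for `t ≥ 1`**: `Θ_n(·,t) ≡ 1` (the vertical ray alone connects `0` to
`∂Λ_n`, no bond is pivotal). [folklore] -/
theorem deriv_theta_p_of_one_le_t {t : ℝ} (ht : 1 ≤ t) (n : ℕ) (p : ℝ) :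
    deriv (fun q : ℝ => Θ[n, q, t]) p = 0 := by
  have h : (fun q : ℝ => Θ[n, q, t]) = fun _ => (1 : ℝ) :=
    funext fun q => theta_eq_one_of_one_le_t ht n q
  rw [h, deriv_const]

/-- **`deriv (Θ_n(·,t)) 0 = 0`**: `0` is a (non-strict) local minimum of `Θ_n(·,t)` — plateau
`Θ_n(q,t) = Θ_n(0,t)` for `q ≤ 0`, monotone for `q ≥ 0` — so Fermat's theorem (which in Mathlib
also covers the non-differentiable corner, where `deriv` is the junk value `0`) gives `0`.
[folklore] -/
theorem deriv_theta_p_at_zero (n : ℕ) (t : ℝ) : deriv (fun q : ℝ => Θ[n, q, t]) 0 = 0 := by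
  refine IsLocalMin.deriv_eq_zero (Filter.Eventually.of_forall fun q => ?_)
  show Θ[n, 0, t] ≤ Θ[n, q, t]
  rcases le_total q 0 with hq | hq
  · rw [theta_eq_theta_zero_of_nonpos hq]
  · exact theta_mono_p n t hq

/-! ## Tightness of the open-square guard in clause (8) of `ModelFacts` -/

/-- **Clause (8) is false on the edge `p = 1`.** With the crux's own `let`-prefix, strict
positivity `0 < deriv (fun q => Θ n q t) p` FAILS if `p` ranges over `Ioc 0 1` instead of
`Ioo 0 1`: at `p = 1`, `Θ_n(·,t)` is maximal and its derivative vanishes (witness `n = 1`,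
`p = 1`, `t = 1/2`). So `p < 1` in clause (8) is load-bearing. [folklore] -/
theorem modelFacts_derivPos_false_at_p_one :
    ¬ (let μ := Literature.Probability.Percolation.labelMeasure (Literature.Probability.LatticeModels.Site 3)
       let vert : Sym2 (Literature.Probability.LatticeModels.Site 3) → Prop :=
         fun e => ∃ x : Literature.Probability.LatticeModels.Site 3, e = s(x, x + Pi.single (2 : Fin 3) 1)
       let cfg : ℝ → ℝ → (Sym2 (Literature.Probability.LatticeModels.Site 3) → ℝ) →
           Set (Sym2 (Literature.Probability.LatticeModels.Site 3)) :=
         fun p t U => {e | e ∈ (Literature.Probability.LatticeModels.zdGraph 3).edgeSet ∧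
           ((vert e ∧ U e ≤ t) ∨ (¬ vert e ∧ U e ≤ p))}
       let Θ : ℕ → ℝ → ℝ → ℝ :=
         fun n p t => μ.real {U | cfg p t U ∈ Literature.Probability.Percolation.siteToBoundary 3 n}
       ∀ n : ℕ, 1 ≤ n → ∀ p ∈ Set.Ioc (0 : ℝ) 1, ∀ t ∈ Set.Ioo (0 : ℝ) 1,
         0 < deriv (fun q => Θ n q t) p) := by
  intro h
  have h0 := h 1 le_rfl 1 ⟨one_pos, le_rfl⟩ (1 / 2) ⟨by norm_num, by norm_num⟩
  exact h0.ne' (deriv_theta_p_at_one 1 (1 / 2))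

/-- **Clause (8) is false on the edge `p = 0`.** If `p` ranges over `Ico 0 1` instead of
`Ioo 0 1`, strict positivity fails at `p = 0`: `Θ_n(·,t)` is constant on `(-∞,0]` and monotone,
so `0` is a local minimum and `deriv` vanishes there (Fermat; at the corner `deriv` is Lean's junk
`0`). Witness `n = 1`, `p = 0`, `t = 1/2`. So `0 < p` in clause (8) is load-bearing. [folklore] -/
theorem modelFacts_derivPos_false_at_p_zero :
    ¬ (let μ := Literature.Probability.Percolation.labelMeasure (Literature.Probability.LatticeModels.Site 3)
       let vert : Sym2 (Literature.Probability.LatticeModels.Site 3) → Prop :=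
         fun e => ∃ x : Literature.Probability.LatticeModels.Site 3, e = s(x, x + Pi.single (2 : Fin 3) 1)
       let cfg : ℝ → ℝ → (Sym2 (Literature.Probability.LatticeModels.Site 3) → ℝ) →
           Set (Sym2 (Literature.Probability.LatticeModels.Site 3)) :=
         fun p t U => {e | e ∈ (Literature.Probability.LatticeModels.zdGraph 3).edgeSet ∧
           ((vert e ∧ U e ≤ t) ∨ (¬ vert e ∧ U e ≤ p))}
       let Θ : ℕ → ℝ → ℝ → ℝ :=
         fun n p t => μ.real {U | cfg p t U ∈ Literature.Probability.Percolation.siteToBoundary 3 n}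
       ∀ n : ℕ, 1 ≤ n → ∀ p ∈ Set.Ico (0 : ℝ) 1, ∀ t ∈ Set.Ioo (0 : ℝ) 1,
         0 < deriv (fun q => Θ n q t) p) := by
  intro h
  have h0 := h 1 le_rfl 0 ⟨le_rfl, one_pos⟩ (1 / 2) ⟨by norm_num, by norm_num⟩
  exact h0.ne' (deriv_theta_p_at_zero 1 (1 / 2))

/-- **Clause (8) is false on the edge `t = 1`.** If `t` ranges over `Ioc 0 1` instead of
`Ioo 0 1`, strict positivity of the `p`-derivative fails at `t = 1`: the vertical ray is open, so
`Θ_n(·,1) ≡ 1` and `∂_pΘ_n(p,1) = 0` for every `p` (witness `n = 1`, `p = 1/2`, `t = 1`). So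
`t < 1` in clause (8) is load-bearing. (The edge `t = 0` is not: there `∂_pΘ_n(p,0) > 0` still
holds, a.s. planar percolation in the layer `ℤ²×{0}` — not proved here.) [folklore] -/
theorem modelFacts_derivPos_false_at_t_one :
    ¬ (let μ := Literature.Probability.Percolation.labelMeasure (Literature.Probability.LatticeModels.Site 3)
       let vert : Sym2 (Literature.Probability.LatticeModels.Site 3) → Prop :=
         fun e => ∃ x : Literature.Probability.LatticeModels.Site 3, e = s(x, x + Pi.single (2 : Fin 3) 1)
       let cfg : ℝ → ℝ → (Sym2 (Literature.Probability.LatticeModels.Site 3) → ℝ) →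
           Set (Sym2 (Literature.Probability.LatticeModels.Site 3)) :=
         fun p t U => {e | e ∈ (Literature.Probability.LatticeModels.zdGraph 3).edgeSet ∧
           ((vert e ∧ U e ≤ t) ∨ (¬ vert e ∧ U e ≤ p))}
       let Θ : ℕ → ℝ → ℝ → ℝ :=
         fun n p t => μ.real {U | cfg p t U ∈ Literature.Probability.Percolation.siteToBoundary 3 n}
       ∀ n : ℕ, 1 ≤ n → ∀ p ∈ Set.Ioo (0 : ℝ) 1, ∀ t ∈ Set.Ioc (0 : ℝ) 1,
         0 < deriv (fun q => Θ n q t) p) := by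
  intro h
  have h0 := h 1 le_rfl (1 / 2) ⟨by norm_num, by norm_num⟩ 1 ⟨one_pos, le_rfl⟩
  exact h0.ne' (deriv_theta_p_of_one_le_t le_rfl 1 (1 / 2))

/-! ## (a″) The fourth edge `t = 0` is NOT load-bearing — PROVED (positive strengthening)

At `t = 0` the vertical bonds are a.s. closed and the model is a.s. planar bond percolation in
the layer `Λ_n ∩ (ℤ²×{0})`; the straight `x`-ray bond `e₀ = s(0,e_x)` is pivotal with positive
probability for `0 < p < 1`, so `∂_pΘ_n(p,0) > 0` for `n ≥ 1`.  The landed `stub_pivotalPos` does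
not apply verbatim (it asks `0 < q_e` on EVERY lattice bond, violated by `q ≡ 0` on vertical bonds
at `t = 0`), but its landed geometric core `PivotalPos.localCylinder_subset_pivotal` is
hypothesis-free, and the cylinder "x-ray beyond `e_x` open, every other pair of `Λ_n` closed"
only needs positive parameters ON THE `x`-RAY.  So clause (8) survives on `t = 0` (indeed on all
`t ≤ 0` and, by the same proof, for every real `t < 1`): the guard `0 < t` is removable —
information for provers, not a defect of the crux. -/

section TZero

open Classical in
/-- Threshold field of the `t = 0` slice: `0` on vertical bonds, `q` on the others. -/
def τ0 (q : ℝ) (e : Sym2 (Site 3)) : ℝ := if Vert(e) then 0 else q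

/-- Parameter field of the `t = 0` slice: `projIcc (τ0 q e)` on `E(ℤ³)`, `0` off it. -/
def param0 (q : ℝ) : Sym2 (Site 3) → unitInterval :=
  (zdGraph 3).edgeSet.indicator fun e => Set.projIcc (0 : ℝ) 1 zero_le_one (τ0 q e)

theorem τ0_of_vert {e : Sym2 (Site 3)} (h : Vert(e)) (q : ℝ) : τ0 q e = 0 := by
  unfold τ0; rw [if_pos h]

theorem τ0_of_not_vert {e : Sym2 (Site 3)} (h : ¬ Vert(e)) (q : ℝ) : τ0 q e = q := by
  unfold τ0; rw [if_neg h]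

theorem param0_of_mem {e : Sym2 (Site 3)} (he : e ∈ (zdGraph 3).edgeSet) (q : ℝ) :
    param0 q e = Set.projIcc (0 : ℝ) 1 zero_le_one (τ0 q e) :=
  Set.indicator_of_mem he _

theorem param0_of_not_mem {e : Sym2 (Site 3)} (he : e ∉ (zdGraph 3).edgeSet) (q : ℝ) :
    param0 q e = 0 :=
  Set.indicator_of_notMem he _

/-- The `t = 0` configuration is thresholding at the field `τ0`. -/
theorem cfg_t0_eq (q : ℝ) (U : Sym2 (Site 3) → ℝ) :
    Cfg(q, 0, U) = {e | e ∈ (zdGraph 3).edgeSet ∧ U e ≤ τ0 q e} := by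
  ext e
  simp only [Set.mem_setOf_eq]
  by_cases h : Vert(e)
  · rw [τ0_of_vert h]
    constructor
    · rintro ⟨he, ⟨-, hU⟩ | ⟨hv, -⟩⟩
      · exact ⟨he, hU⟩
      · exact (hv h).elim
    · rintro ⟨he, hU⟩
      exact ⟨he, Or.inl ⟨h, hU⟩⟩
  · rw [τ0_of_not_vert h]
    constructor
    · rintro ⟨he, ⟨hv, -⟩ | ⟨-, hU⟩⟩
      · exact (h hv).elim
      · exact ⟨he, hU⟩
    · rintro ⟨he, hU⟩
      exact ⟨he, Or.inr ⟨h, hU⟩⟩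

/-- Thresholding maps are measurable (pattern `measurable_configOfLabels`). -/
theorem measurable_threshold (E : Set (Sym2 (Site 3))) (σ : Sym2 (Site 3) → ℝ) :
    Measurable fun U : Sym2 (Site 3) → ℝ => {e | e ∈ E ∧ U e ≤ σ e} :=
  measurable_set_iff.2 fun e =>
    (show Measurable fun s : ℝ => (e ∈ E ∧ s ≤ σ e) from
      measurable_const.and (measurableSet_setOf.1 measurableSet_Iic)).comp (measurable_pi_apply e)

/-- **`Θ_n(q,0)` is a `prodBernoulli` probability** (landed `stub_pushforward`, p165705). -/
theorem theta_t0_eq (n : ℕ) (q : ℝ) :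
    Θ[n, q, 0] = (prodBernoulli (param0 q)).real (siteToBoundary 3 n) := by
  have hmap :=
    Summit.CriticalPhenomena.PercolationContinuityZ3.Theorems.ModelFacts.stub_pushforward
      (zdGraph 3).edgeSet (τ0 q)
  have hset : {U : Sym2 (Site 3) → ℝ | Cfg(q, 0, U) ∈ siteToBoundary 3 n} =
      (fun U : Sym2 (Site 3) → ℝ => {e | e ∈ (zdGraph 3).edgeSet ∧ U e ≤ τ0 q e}) ⁻¹'
        siteToBoundary 3 n := by
    ext U
    show Cfg(q, 0, U) ∈ siteToBoundary 3 n ↔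
      {e | e ∈ (zdGraph 3).edgeSet ∧ U e ≤ τ0 q e} ∈ siteToBoundary 3 n
    rw [cfg_t0_eq q U]
  rw [hset, measureReal_def, measureReal_def,
    ← Measure.map_apply (measurable_threshold _ _) (measurableSet_siteToBoundary 3 n), hmap]
  rfl

theorem hasDerivAt_param0_horiz {e : Sym2 (Site 3)} (he : e ∈ (zdGraph 3).edgeSet)
    (hv : ¬ Vert(e)) {p : ℝ} (hp : p ∈ Set.Ioo (0 : ℝ) 1) :
    HasDerivAt (fun b : ℝ => (param0 b e : ℝ)) 1 p := by
  have heq : (fun b : ℝ => b) =ᶠ[𝓝 p] fun b : ℝ => (param0 b e : ℝ) := by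
    filter_upwards [Ioo_mem_nhds hp.1 hp.2] with b hb
    rw [param0_of_mem he, τ0_of_not_vert hv, Set.projIcc_of_mem _ (Set.Ioo_subset_Icc_self hb)]
  exact (hasDerivAt_id p).congr_of_eventuallyEq heq.symm

theorem hasDerivAt_param0_vert {e : Sym2 (Site 3)} (he : e ∈ (zdGraph 3).edgeSet) (hv : Vert(e))
    (p : ℝ) : HasDerivAt (fun b : ℝ => (param0 b e : ℝ)) 0 p := by
  have hfun : (fun b : ℝ => (param0 b e : ℝ)) =
      fun _ => (Set.projIcc (0 : ℝ) 1 zero_le_one 0 : ℝ) := by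
    funext b; rw [param0_of_mem he, τ0_of_vert hv]
  rw [hfun]
  exact hasDerivAt_const _ _

theorem hasDerivAt_param0_not_mem {e : Sym2 (Site 3)} (he : e ∉ (zdGraph 3).edgeSet) (p : ℝ) :
    HasDerivAt (fun b : ℝ => (param0 b e : ℝ)) 0 p := by
  have hfun : (fun b : ℝ => (param0 b e : ℝ)) = fun _ => (0 : ℝ) := by
    funext b; rw [param0_of_not_mem he]; rfl
  rw [hfun]
  exact hasDerivAt_const _ _

/-- Every parameter of the `t = 0` slice is `< 1` for `0 < p < 1`. -/
theorem param0_lt_one {p : ℝ} (hp : p ∈ Set.Ioo (0 : ℝ) 1) (e : Sym2 (Site 3)) :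
    (param0 p e : ℝ) < 1 := by
  by_cases he : e ∈ (zdGraph 3).edgeSet
  · rw [param0_of_mem he]
    by_cases hv : Vert(e)
    · rw [τ0_of_vert hv, Set.projIcc_left]
      exact zero_lt_one
    · rw [τ0_of_not_vert hv, Set.projIcc_of_mem _ (Set.Ioo_subset_Icc_self hp)]
      exact hp.2
  · rw [param0_of_not_mem he]
    exact zero_lt_one

/-- The parameters of the `x`-ray bonds are `p > 0`. -/
theorem param0_xray_pos {p : ℝ} (hp : p ∈ Set.Ioo (0 : ℝ) 1) (k : ℕ) :
    0 < (param0 p s((Pi.single (0 : Fin 3) (k : ℤ) : Site 3),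
      Pi.single (0 : Fin 3) ((k + 1 : ℕ) : ℤ)) : ℝ) := by
  rw [param0_of_mem ((SimpleGraph.mem_edgeSet _).2 (axis_adj_succ 0 k)),
    τ0_of_not_vert (not_vert_axis_zero k), Set.projIcc_of_mem _ (Set.Ioo_subset_Icc_self hp)]
  exact hp.1

/-! ### Geometry of the `x`-ray cylinder (verbatim from the landed `stub_pivotalPos` file,
`Theorems/PercExchangeRateTransportModelFactsStubPivotalPos.lean`, p166253 — copied rather than
imported only because that module was not yet built on the farm when this file was written) -/

/-- The bonds `s(k e_x, (k+1) e_x)`, `k ≥ 1`, avoid the origin. [folklore] -/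
theorem zero_notMem_bond {k : ℕ} (hk : 1 ≤ k) :
    (0 : Site 3) ∉
      s((Pi.single (0 : Fin 3) (k : ℤ) : Site 3), Pi.single (0 : Fin 3) ((k + 1 : ℕ) : ℤ)) := by
  rw [Sym2.mem_iff]
  rintro (h | h) <;> have h0 := congr_fun h 0 <;>
    simp only [Pi.single_eq_same, Pi.zero_apply] at h0 <;> omega

/-- `e₀ = s(0, e_x)` is a pair of sites of `Λ_n` for `n ≥ 1`. [folklore] -/
theorem e0_mem_sym2_box {n : ℕ} (hn : 1 ≤ n) :
    s((0 : Site 3), Pi.single (0 : Fin 3) 1) ∈ (box 3 n).sym2 := by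
  rw [Finset.mk_mem_sym2_iff]
  refine ⟨zero_mem_box 3 n, ?_⟩
  have h := axis_mem_box (0 : Fin 3) (n := n) (k := 1) hn
  rwa [Nat.cast_one] at h

/-- `e₀` is not one of the bonds `s(k e_x, (k+1) e_x)`, `1 ≤ k < n`. [folklore] -/
theorem e0_notMem (n : ℕ) :
    s((0 : Site 3), Pi.single (0 : Fin 3) 1) ∉ {e : Sym2 (Site 3) | ∃ k : ℕ, 1 ≤ k ∧ k < n ∧
      e = s((Pi.single (0 : Fin 3) (k : ℤ) : Site 3),
        Pi.single (0 : Fin 3) ((k + 1 : ℕ) : ℤ))} := by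
  rintro ⟨k, hk1, -, hk⟩
  exact zero_notMem_bond hk1 (by rw [← hk]; exact Sym2.mem_mk_left _ _)

/-- Opening `e₀` on the cylinder connects `0` to `∂Λ_n` along the `x`-ray. [folklore] -/
theorem insert_mem_siteToBoundary {n : ℕ} {ω : Set (Sym2 (Site 3))}
    (hω : ω ∈ localCylinder (↑((box 3 n).sym2) : Set (Sym2 (Site 3)))
      {e | ∃ k : ℕ, 1 ≤ k ∧ k < n ∧
        e = s((Pi.single (0 : Fin 3) (k : ℤ) : Site 3), Pi.single (0 : Fin 3) ((k + 1 : ℕ) : ℤ))}) :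
    insert s((0 : Site 3), Pi.single (0 : Fin 3) 1) ω ∈ siteToBoundary 3 n := by
  rw [mem_siteToBoundary_iff]
  refine ⟨Pi.single 0 (n : ℤ), axis_mem_innerBoundary 0 n, ?_⟩
  suffices h : ∀ k, k ≤ n →
      PathIn (openGraph (insert s((0 : Site 3), Pi.single (0 : Fin 3) 1) ω)) ↑(box 3 n) 0
        (Pi.single (0 : Fin 3) (k : ℤ)) from h n le_rfl
  intro k
  induction k with
  | zero =>
    intro _
    simp only [Nat.cast_zero, Pi.single_zero]
    exact PathIn.refl (zero_mem_box 3 n)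
  | succ k ih =>
    intro hk
    refine (ih (Nat.le_of_succ_le hk)).tail ?_ (axis_mem_box 0 hk)
    rw [openGraph_adj]
    refine ⟨?_, (axis_adj_succ 0 k).ne⟩
    rcases Nat.eq_zero_or_pos k with rfl | hk0
    · simp
    · refine Set.mem_insert_of_mem _ ((hω _ ?_).2 ⟨k, hk0, Nat.lt_of_succ_le hk, rfl⟩)
      exact Finset.mk_mem_sym2_iff.2 ⟨axis_mem_box 0 (Nat.le_of_succ_le hk), axis_mem_box 0 hk⟩

/-- Without `e₀` the origin is cut off on the cylinder (`n ≥ 1`). [folklore] -/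
theorem notMem_siteToBoundary {n : ℕ} (hn : 1 ≤ n) {ω : Set (Sym2 (Site 3))}
    (hω : ω ∈ localCylinder (↑((box 3 n).sym2) : Set (Sym2 (Site 3)))
      {e | ∃ k : ℕ, 1 ≤ k ∧ k < n ∧
        e = s((Pi.single (0 : Fin 3) (k : ℤ) : Site 3), Pi.single (0 : Fin 3) ((k + 1 : ℕ) : ℤ))}) :
    ω ∉ siteToBoundary 3 n := by
  rw [mem_siteToBoundary_iff]
  rintro ⟨y, hy, hpath⟩
  have hy0 : y ≠ 0 := by
    rintro rfl
    exact notMem_box_of_mem_innerBoundary_box (Nat.lt_of_succ_le hn) hy (zero_mem_box 3 0)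
  refine hy0 (pathIn_induction (fun z => z = (0 : Site 3)) hpath rfl ?_)
  rintro a b - hb rfl hab
  exfalso
  have h1 : s((0 : Site 3), b) ∈ ω := ((openGraph_adj ω 0 b).1 hab).1
  have h2 : s((0 : Site 3), b) ∈ (↑((box 3 n).sym2) : Set (Sym2 (Site 3))) :=
    Finset.mk_mem_sym2_iff.2 ⟨zero_mem_box 3 n, hb⟩
  obtain ⟨k, hk1, -, hk⟩ := (hω _ h2).1 h1
  exact zero_notMem_bond hk1 (by rw [← hk]; exact Sym2.mem_mk_left _ _)

/-- The cylinder lies in `{e₀ pivotal for {0 ⟷ ∂Λ_n}}` (`n ≥ 1`). [folklore] -/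
theorem localCylinder_subset_pivotal {n : ℕ} (hn : 1 ≤ n) :
    localCylinder (↑((box 3 n).sym2) : Set (Sym2 (Site 3)))
        {e | ∃ k : ℕ, 1 ≤ k ∧ k < n ∧
          e = s((Pi.single (0 : Fin 3) (k : ℤ) : Site 3),
            Pi.single (0 : Fin 3) ((k + 1 : ℕ) : ℤ))} ⊆
      {ω | IsPivotal (siteToBoundary 3 n) s((0 : Site 3), Pi.single (0 : Fin 3) 1) ω} := by
  intro ω hω
  have he₀ : s((0 : Site 3), Pi.single (0 : Fin 3) 1) ∉ ω :=
    fun h => e0_notMem n ((hω _ (Finset.mem_coe.2 (e0_mem_sym2_box hn))).1 h)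
  rw [Set.mem_setOf_eq, Russo.isPivotal_iff_of_notMem (isUpperSet_siteToBoundary 3 n) he₀]
  exact ⟨insert_mem_siteToBoundary hω, notMem_siteToBoundary hn hω⟩

/-- The cylinder "x-ray beyond `e_x` open, all other pairs of `Λ_n` closed" has positive
probability under the `t = 0` slice (only the `x`-ray parameters need to be positive). -/
theorem cylinder_t0_pos {p : ℝ} (hp : p ∈ Set.Ioo (0 : ℝ) 1) (n : ℕ) :
    0 < (prodBernoulli (param0 p)).real (localCylinder (↑((box 3 n).sym2) : Set (Sym2 (Site 3)))
        {e | ∃ k : ℕ, 1 ≤ k ∧ k < n ∧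
          e = s((Pi.single (0 : Fin 3) (k : ℤ) : Site 3),
            Pi.single (0 : Fin 3) ((k + 1 : ℕ) : ℤ))}) := by
  classical
  rw [Literature.Probability.Percolation.prodBernoulli_real_localCylinder]
  refine Finset.prod_pos fun e _ => ?_
  split_ifs with he
  · obtain ⟨k, -, -, rfl⟩ := he
    exact param0_xray_pos hp k
  · exact sub_pos.2 (param0_lt_one hp e)

theorem e0_mem_edgeSet : s((0 : Site 3), Pi.single (0 : Fin 3) 1) ∈ (zdGraph 3).edgeSet := by
  rw [SimpleGraph.mem_edgeSet, zdGraph_adj_iff]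
  exact ⟨0, Or.inl (by simp)⟩

theorem not_vert_e0 : ¬ Vert(s((0 : Site 3), Pi.single (0 : Fin 3) 1)) := by
  rintro ⟨x, hx⟩
  rw [Sym2.eq_iff] at hx
  rcases hx with ⟨h0, h1⟩ | ⟨h0, h1⟩
  · have := congrFun h1 0
    rw [← h0] at this
    simp at this
  · have := congrFun h0 0
    rw [← h1] at this
    simp at this

/-- **Clause (8) survives on the edge `t = 0`** (the guard `0 < t` is NOT load-bearing):
`0 < ∂_pΘ_n(p,0)` for `n ≥ 1`, `0 < p < 1`.  Two-parameter Russo along `b ↦ param0 b`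
(tree `hasDerivAt_prodBernoulli_real`), the sum bounded below by its `e₀`-term, which dominates
the positive cylinder probability (`localCylinder_subset_pivotal`, the geometry of the landed
`stub_pivotalPos`, p166253). -/
theorem clause8_holds_at_t_zero (n : ℕ) (hn : 1 ≤ n) (p : ℝ) (hp : p ∈ Set.Ioo (0 : ℝ) 1) :
    0 < deriv (fun q : ℝ => Θ[n, q, 0]) p := by
  classical
  have hfun : (fun q : ℝ => Θ[n, q, 0]) =
      fun q => (prodBernoulli (param0 q)).real (siteToBoundary 3 n) :=
    funext fun q => theta_t0_eq n q
  -- coordinate derivatives of the path `b ↦ param0 b`: `1` on horizontal lattice bonds, else `0`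
  let p' : Sym2 (Site 3) → ℝ := fun e => if e ∈ (zdGraph 3).edgeSet ∧ ¬ Vert(e) then 1 else 0
  have hp'1 : ∀ e, e ∈ (zdGraph 3).edgeSet → ¬ Vert(e) → p' e = 1 := fun e he hv => by
    simp only [p']; rw [if_pos ⟨he, hv⟩]
  have hp'0v : ∀ e, Vert(e) → p' e = 0 := fun e hv => by
    simp only [p']; rw [if_neg (fun h => h.2 hv)]
  have hp'0n : ∀ e, e ∉ (zdGraph 3).edgeSet → p' e = 0 := fun e he => by
    simp only [p']; rw [if_neg (fun h => he h.1)]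
  have hp'nn : ∀ e, 0 ≤ p' e := fun e => by
    simp only [p']; split_ifs <;> norm_num
  have hderiv : ∀ e ∈ (box 3 n).sym2, HasDerivAt (fun b : ℝ => (param0 b e : ℝ)) (p' e) p := by
    intro e _
    by_cases he : e ∈ (zdGraph 3).edgeSet
    · by_cases hv : Vert(e)
      · rw [hp'0v e hv]; exact hasDerivAt_param0_vert he hv p
      · rw [hp'1 e he hv]; exact hasDerivAt_param0_horiz he hv hp
    · rw [hp'0n e he]; exact hasDerivAt_param0_not_mem he p
  have hR := hasDerivAt_prodBernoulli_real (fun b : ℝ => param0 b)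
    (isUpperSet_siteToBoundary 3 n) (determinedBy_siteToBoundary 3 n) p p' hderiv
  rw [hfun, hR.deriv]
  have hnn : ∀ e ∈ (box 3 n).sym2, 0 ≤ p' e *
      (prodBernoulli (param0 p)).real {ω | IsPivotal (siteToBoundary 3 n) e ω} :=
    fun e _ => mul_nonneg (hp'nn e) measureReal_nonneg
  refine lt_of_lt_of_le ?_ (Finset.single_le_sum hnn (e0_mem_sym2_box hn))
  rw [hp'1 _ e0_mem_edgeSet not_vert_e0, one_mul]
  exact (cylinder_t0_pos hp n).trans_le (measureReal_mono (localCylinder_subset_pivotal hn))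

end TZero

/-! ## Line `pushforward` (picked sketch `ModelFacts-ideate-r1-k1-Sketch`) — joint sufficiency

Nothing to attack: the registered skeleton `Cruxes/ModelFacts/Lines/pushforward.lean`
(sha b7532b73) proves `ModelFacts_of : stub_pushforward → stub_contDiff → stub_pivotalPos →
stub_contAbove → stub_planar → ModelFacts` WITHOUT `sorry` (kernel-checked glue, axioms
propext/Classical.choice/Quot.sound per the skeleton vet), and all five stubs are LANDED verbatim:
`stub_pushforward` p165705, `stub_contDiff` p165963, `stub_pivotalPos` p166253, `stub_contAbove`
p166100, `stub_planar` p165641 (`Theorems/PercExchangeRateTransportModelFactsStub*.lean`).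
Hence the crux is a theorem pending the lead's assembly; no stub can be false and the glue cannot
smuggle a gap.  `-- Targets`: none (payload `stuck_stubs = []`).

Sanity restatement of the degenerate-box record (landed p145365, `Negative/DerivPosGuard.lean`): -/

example : siteToBoundary 3 0 = Set.univ :=
  Summit.CriticalPhenomena.PercolationContinuityZ3.Theorems.ModelFacts.Negative.siteToBoundary_three_zero

end Summit.CriticalPhenomena.PercolationContinuityZ3.Cruxes.ModelFacts.Disproof

end
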